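import Literature.MathematicalPhysics.QuantumLattice.WilsonDiracAP
import Literature.MathematicalPhysics.QuantumLattice.GrassmannIntegralProofs
import Literature.Probability.LatticeModels.TorusFourierProofs

/-!
# Kernel algebra for the linear term of the tangent functional
(helpers of the lead's stub `stub_freeTangentBound_of`, line `Sketch`, idea `free-tangent-landau-chessboard`,
crux `QuarksAsStableAction.WilsonQuarkStability`, item stmt-QuantumFields-9736)

* `sum_kernel_mul_forward_block`, `sum_kernel_mul_backward_block`, `trace_kernel_mul_delta`: a colour-blind
  kernel `Dinv_{pq} = δ_{ab} K(x,y)_{αβ}` contracted against the eight hopping blocks of the perturbation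
  `Δ = D[ω V] − D[ω]` gives `Tr(Dinv Δ) = -(1/2) Σ_μ [Σ_y tr(K(y+e_μ,y)(1−γ_μ)) tr Cf_μ(y) + Σ_x tr(K(x,x+e_μ)(1+γ_μ)) tr Cb_μ(x)]`;
* `trace_euclideanGamma_mul` (`tr γ_ν γ_μ = 4δ`), `trace_euclideanGamma'` (`tr γ_μ = 0`) and the spin-trace identity
  `trace_symbol_identity`: `tr(Mᴴ(1 − γ_μ)) + tr(M(1 + γ_μ)) = 8w + 8 i s_μ` for the symbol `M = w + iΣ s_ν γ_ν`;
* `trace_kernel_shift_left/right`: the Fourier kernel `L⁻⁴ Σ_k χ_k(x) conj χ_k(y) M(k)ᴴ/h(k)` at separation one;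
* `val_neg_sub_one`, `apAngle_reflect`, `reflect_involutive`, `conj_sum_apCoefficient`: the reflection `k ↦ -k-1`
  maps the antiperiodic angle `φ = (2k+1)π/L` to `2π − φ`, whence the linear coefficient
  `Z_μ = Σ_k e^{iφ_μ}(w + i sin φ_μ)/h` is REAL; `norm_sum_apCoefficient_le`: `‖Z_μ‖ ≤ (|m| + 9) Σ_k 1/h`.

Pure theorem file (no definitions).
-/
namespace Summit.QuantumFields.QCD.Cruxes.WilsonQuarkStability.FreeTangentLandauChessboard

open Literature.MathematicalPhysics Literature.MathematicalPhysics.QuantumLattice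
  Literature.MathematicalPhysics.QuantumFieldTheory Literature.Probability.LatticeModels
open Matrix Complex
open scoped Kronecker ComplexOrder ComplexConjugate BigOperators

noncomputable section

variable {L : ℕ} [NeZero L]

/-- A colour-blind kernel contracted against a forward hopping block: the sums over the two
multi-indices collapse to `tr(K(y + e_μ, y) G) · tr C(y)` summed over sites. -/
theorem sum_kernel_mul_forward_block (K : TorusSite 4 L → TorusSite 4 L → Matrix (Fin 4) (Fin 4) ℂ)
    (G : Matrix (Fin 4) (Fin 4) ℂ) (C : TorusSite 4 L → Matrix (Fin 3) (Fin 3) ℂ) (μ : Fin 4) :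
    ∑ p : TorusSite 4 L × Fin 3 × Fin 4, ∑ q : TorusSite 4 L × Fin 3 × Fin 4,
      (if p.2.1 = q.2.1 then K p.1 q.1 p.2.2 q.2.2 else 0) *
        (if p.1 = QuantumFieldTheory.Site.shift q.1 μ then G q.2.2 p.2.2 * C q.1 q.2.1 p.2.1 else 0) =
      ∑ y : TorusSite 4 L, (K (QuantumFieldTheory.Site.shift y μ) y * G).trace * (C y).trace := by
  -- swap the two multi-index sums and evaluate the `p`-sum first
  rw [Finset.sum_comm]
  rw [Fintype.sum_prod_type]
  refine Finset.sum_congr rfl fun y _ => ?_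
  -- for fixed `q = (y, b, β)` the `p`-sum picks `p = (y + e_μ, b, α')`
  have hp : ∀ bβ : Fin 3 × Fin 4, ∑ p : TorusSite 4 L × Fin 3 × Fin 4,
      (if p.2.1 = bβ.1 then K p.1 y p.2.2 bβ.2 else 0) *
        (if p.1 = QuantumFieldTheory.Site.shift y μ then G bβ.2 p.2.2 * C y bβ.1 p.2.1 else 0) =
      ∑ α', K (QuantumFieldTheory.Site.shift y μ) y α' bβ.2 * (G bβ.2 α' * C y bβ.1 bβ.1) := by
    intro bβ
    rw [Fintype.sum_prod_type, Finset.sum_eq_single (QuantumFieldTheory.Site.shift y μ)]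
    · rw [Fintype.sum_prod_type, Finset.sum_eq_single bβ.1]
      · simp
      · intro b _ hb
        simp [hb]
      · simp
    · intro x _ hx
      simp [hx]
    · simp
  simp_rw [hp]
  -- now both sides are finite sums over colour and spin indices
  rw [Fintype.sum_prod_type]
  simp only [trace, diag, mul_apply]
  rw [Finset.sum_mul_sum]
  simp_rw [Finset.sum_mul]
  conv_rhs => rw [Finset.sum_comm]
  refine Finset.sum_congr rfl fun b _ => ?_
  rw [Finset.sum_comm]
  refine Finset.sum_congr rfl fun α' _ => Finset.sum_congr rfl fun β _ => ?_
  ring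

/-- A colour-blind kernel contracted against a backward hopping block: the sums collapse to
`tr(K(x, x + e_μ) G) · tr C(x)` summed over sites. -/
theorem sum_kernel_mul_backward_block (K : TorusSite 4 L → TorusSite 4 L → Matrix (Fin 4) (Fin 4) ℂ)
    (G : Matrix (Fin 4) (Fin 4) ℂ) (C : TorusSite 4 L → Matrix (Fin 3) (Fin 3) ℂ) (μ : Fin 4) :
    ∑ p : TorusSite 4 L × Fin 3 × Fin 4, ∑ q : TorusSite 4 L × Fin 3 × Fin 4,
      (if p.2.1 = q.2.1 then K p.1 q.1 p.2.2 q.2.2 else 0) *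
        (if q.1 = QuantumFieldTheory.Site.shift p.1 μ then G q.2.2 p.2.2 * C p.1 q.2.1 p.2.1 else 0) =
      ∑ x : TorusSite 4 L, (K x (QuantumFieldTheory.Site.shift x μ) * G).trace * (C x).trace := by
  rw [Fintype.sum_prod_type]
  refine Finset.sum_congr rfl fun x _ => ?_
  have hq : ∀ aα : Fin 3 × Fin 4, ∑ q : TorusSite 4 L × Fin 3 × Fin 4,
      (if aα.1 = q.2.1 then K x q.1 aα.2 q.2.2 else 0) *
        (if q.1 = QuantumFieldTheory.Site.shift x μ then G q.2.2 aα.2 * C x q.2.1 aα.1 else 0) =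
      ∑ β, K x (QuantumFieldTheory.Site.shift x μ) aα.2 β * (G β aα.2 * C x aα.1 aα.1) := by
    intro aα
    rw [Fintype.sum_prod_type, Finset.sum_eq_single (QuantumFieldTheory.Site.shift x μ)]
    · rw [Fintype.sum_prod_type, Finset.sum_eq_single aα.1]
      · simp
      · intro b _ hb
        simp [Ne.symm hb]
      · simp
    · intro y _ hy
      simp [hy]
    · simp
  simp_rw [hq]
  rw [Fintype.sum_prod_type]
  simp only [trace, diag, mul_apply]
  rw [Finset.sum_mul_sum]
  simp_rw [Finset.sum_mul]
  conv_rhs => rw [Finset.sum_comm]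
  refine Finset.sum_congr rfl fun a _ => Finset.sum_congr rfl fun α _ => Finset.sum_congr rfl fun β _ => ?_
  ring

/-- **Trace of a colour-blind kernel against the perturbation.**  If `Dinv_{pq} = δ_{ab} K(x,y)_{αβ}` and
`Δ` has the hopping-block entries of `D[ω V] − D[ω]` (forward blocks `Gm μ ⊗ Cf μ x`, backward blocks
`Gp μ ⊗ Cb μ y`), then
`Tr(Dinv Δ) = -(1/2) Σ_μ [Σ_y tr(K(y+e_μ,y) Gm_μ) tr Cf_μ(y) + Σ_x tr(K(x,x+e_μ) Gp_μ) tr Cb_μ(x)]`. -/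
theorem trace_kernel_mul_delta
    (K : TorusSite 4 L → TorusSite 4 L → Matrix (Fin 4) (Fin 4) ℂ)
    (Dinv Δ : Matrix (TorusSite 4 L × Fin 3 × Fin 4) (TorusSite 4 L × Fin 3 × Fin 4) ℂ)
    (hDinv : ∀ p q, Dinv p q = if p.2.1 = q.2.1 then K p.1 q.1 p.2.2 q.2.2 else 0)
    (Gm Gp : Fin 4 → Matrix (Fin 4) (Fin 4) ℂ)
    (Cf Cb : Fin 4 → TorusSite 4 L → Matrix (Fin 3) (Fin 3) ℂ)
    (hΔ : ∀ p q, Δ p q = -(1 / 2 : ℂ) * ∑ μ : Fin 4,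
      ((if q.1 = QuantumFieldTheory.Site.shift p.1 μ then Gm μ p.2.2 q.2.2 * Cf μ p.1 p.2.1 q.2.1 else 0) +
        (if p.1 = QuantumFieldTheory.Site.shift q.1 μ then Gp μ p.2.2 q.2.2 * Cb μ q.1 p.2.1 q.2.1 else 0))) :
    (Dinv * Δ).trace = -(1 / 2 : ℂ) * ∑ μ : Fin 4,
      ((∑ y : TorusSite 4 L, (K (QuantumFieldTheory.Site.shift y μ) y * Gm μ).trace * (Cf μ y).trace) +
        ∑ x : TorusSite 4 L, (K x (QuantumFieldTheory.Site.shift x μ) * Gp μ).trace * (Cb μ x).trace) := by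
  have htr : (Dinv * Δ).trace = ∑ p, ∑ q, Dinv p q * Δ q p := by
    simp only [trace, diag, mul_apply]
  rw [htr]
  simp_rw [hDinv, hΔ]
  -- pull out `-(1/2) Σ_μ`
  have : ∀ p q : TorusSite 4 L × Fin 3 × Fin 4,
      (if p.2.1 = q.2.1 then K p.1 q.1 p.2.2 q.2.2 else 0) * (-(1 / 2 : ℂ) * ∑ μ : Fin 4,
        ((if p.1 = QuantumFieldTheory.Site.shift q.1 μ then Gm μ q.2.2 p.2.2 * Cf μ q.1 q.2.1 p.2.1 else 0) +
          (if q.1 = QuantumFieldTheory.Site.shift p.1 μ then Gp μ q.2.2 p.2.2 * Cb μ p.1 q.2.1 p.2.1 else 0))) =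
      -(1 / 2 : ℂ) * ∑ μ : Fin 4,
        ((if p.2.1 = q.2.1 then K p.1 q.1 p.2.2 q.2.2 else 0) *
            (if p.1 = QuantumFieldTheory.Site.shift q.1 μ then Gm μ q.2.2 p.2.2 * Cf μ q.1 q.2.1 p.2.1 else 0) +
          (if p.2.1 = q.2.1 then K p.1 q.1 p.2.2 q.2.2 else 0) *
            (if q.1 = QuantumFieldTheory.Site.shift p.1 μ then Gp μ q.2.2 p.2.2 * Cb μ p.1 q.2.1 p.2.1 else 0)) := by
    intro p q
    rw [mul_left_comm, Finset.mul_sum]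
    simp_rw [mul_add]
  simp_rw [this]
  simp_rw [Finset.mul_sum (s := (Finset.univ : Finset (Fin 4)))]
  -- bring the direction sum outside
  conv_lhs => arg 2; ext p; rw [Finset.sum_comm]
  rw [Finset.sum_comm]
  refine Finset.sum_congr rfl fun μ _ => ?_
  rw [← sum_kernel_mul_forward_block K (Gm μ) (Cf μ) μ, ← sum_kernel_mul_backward_block K (Gp μ) (Cb μ) μ,
    ← Finset.sum_add_distrib, Finset.mul_sum]
  refine Finset.sum_congr rfl fun p _ => ?_
  rw [← Finset.sum_add_distrib, Finset.mul_sum]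

/-! ### Spin traces -/

/-- `tr(γ_ν γ_μ) = 4 δ_{νμ}` (from the Clifford relations). -/
theorem trace_euclideanGamma_mul (ν μ : Fin 4) :
    (euclideanGamma ν * euclideanGamma μ).trace = if ν = μ then 4 else 0 := by
  have hac := euclideanGamma_anticomm_holds ν μ
  have h2 : (2 : ℂ) * (euclideanGamma ν * euclideanGamma μ).trace =
      (if ν = μ then (2 : Matrix (Fin 4) (Fin 4) ℂ) else 0).trace := by
    rw [← hac, trace_add, trace_mul_comm (euclideanGamma μ), two_mul]
  split_ifs at h2 with h
  · rw [show (2 : Matrix (Fin 4) (Fin 4) ℂ) = (2 : ℂ) • (1 : Matrix (Fin 4) (Fin 4) ℂ) by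
        rw [two_smul, ← one_add_one_eq_two], trace_smul, trace_one, Fintype.card_fin] at h2
    rw [if_pos h]
    have : (euclideanGamma ν * euclideanGamma μ).trace = 4 := by
      have h3 : (2 : ℂ) * (euclideanGamma ν * euclideanGamma μ).trace = 2 * 4 := by
        rw [h2]; norm_num
      exact mul_left_cancel₀ two_ne_zero h3
    exact this
  · rw [trace_zero] at h2
    rw [if_neg h]
    exact (mul_eq_zero.mp h2).resolve_left two_ne_zero

/-- The Euclidean gamma matrices are traceless. -/
theorem trace_euclideanGamma' (μ : Fin 4) : (euclideanGamma μ).trace = 0 := by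
  obtain ⟨ν, hν⟩ : ∃ ν : Fin 4, ν ≠ μ := ⟨μ + 1, by fin_cases μ <;> decide⟩
  have hac := euclideanGamma_anticomm_holds μ ν
  rw [if_neg (Ne.symm hν)] at hac
  have hνν : euclideanGamma ν * euclideanGamma ν = 1 := euclideanGamma_mul_self ν
  have h1 : euclideanGamma ν * euclideanGamma μ * euclideanGamma ν = -euclideanGamma μ := by
    have : euclideanGamma ν * euclideanGamma μ = -(euclideanGamma μ * euclideanGamma ν) :=
      eq_neg_of_add_eq_zero_right hac
    rw [this, neg_mul, Matrix.mul_assoc, hνν, Matrix.mul_one]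
  have h2 : (euclideanGamma ν * euclideanGamma μ * euclideanGamma ν).trace =
      (euclideanGamma μ).trace := by
    rw [trace_mul_cycle, hνν, Matrix.one_mul]
  rw [h1, trace_neg] at h2
  have h3 : (2 : ℂ) * (euclideanGamma μ).trace = 0 := by
    rw [two_mul]; nth_rw 1 [← h2]; ring
  simpa using h3

/-- **The spin-trace identity behind the reality of the linear coefficient**: for the symbol
`M = w·1 + i Σ_ν s_ν γ_ν` (`w`, `s` real),
`tr(Mᴴ (1 − γ_μ)) + tr(M (1 + γ_μ)) = 8 w + 8 i s_μ`. -/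
theorem trace_symbol_identity (w : ℝ) (s : Fin 4 → ℝ) (μ : Fin 4) :
    (((w : ℂ) • (1 : Matrix (Fin 4) (Fin 4) ℂ) + I • ∑ ν, ((s ν : ℝ) : ℂ) • euclideanGamma ν)ᴴ *
          ((1 : Matrix (Fin 4) (Fin 4) ℂ) - euclideanGamma μ)).trace +
      (((w : ℂ) • (1 : Matrix (Fin 4) (Fin 4) ℂ) + I • ∑ ν, ((s ν : ℝ) : ℂ) • euclideanGamma ν) *
          ((1 : Matrix (Fin 4) (Fin 4) ℂ) + euclideanGamma μ)).trace =
      8 * w + 8 * I * s μ := by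
  set S : Matrix (Fin 4) (Fin 4) ℂ := ∑ ν, ((s ν : ℝ) : ℂ) • euclideanGamma ν with hS
  have hSH : Sᴴ = S := by
    simp only [hS, conjTranspose_sum, conjTranspose_smul, (euclideanGamma_isHermitian _).eq,
      Complex.star_def, Complex.conj_ofReal]
  have hMH : ((w : ℂ) • (1 : Matrix (Fin 4) (Fin 4) ℂ) + I • S)ᴴ = (w : ℂ) • 1 - I • S := by
    rw [conjTranspose_add, conjTranspose_smul, conjTranspose_smul, conjTranspose_one, hSH]
    simp only [Complex.star_def, Complex.conj_ofReal, Complex.conj_I, neg_smul, sub_eq_add_neg]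
  have htrS : S.trace = 0 := by
    simp [hS, trace_sum, trace_smul, trace_euclideanGamma']
  have htrSγ : (S * euclideanGamma μ).trace = 4 * s μ := by
    simp only [hS, Matrix.sum_mul, Matrix.smul_mul, trace_sum, trace_smul, trace_euclideanGamma_mul,
      smul_eq_mul, mul_ite, mul_zero, Finset.sum_ite_eq', Finset.mem_univ, if_true]
    ring
  have htrγS : (euclideanGamma μ * S).trace = 4 * s μ := by rw [trace_mul_comm, htrSγ]
  rw [hMH]
  simp only [Matrix.add_mul, Matrix.sub_mul, Matrix.mul_add, Matrix.mul_sub, Matrix.smul_mul,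
    Matrix.one_mul, Matrix.mul_one, trace_add, trace_sub, trace_smul, trace_one, Fintype.card_fin,
    trace_euclideanGamma', htrS, htrSγ, smul_eq_mul]
  push_cast
  ring

/-! ### The character at a unit vector -/

/-- `χ_k(e_μ) = exp(2πi k_μ.val / L)`. -/
theorem torusChar_single_eq_exp' (k : TorusSite 4 L) (μ : Fin 4) :
    torusChar k (Pi.single μ 1) = Complex.exp ((2 * Real.pi * ((k μ).val : ℝ) / L : ℝ) * I) := by
  have : torusChar k (Pi.single μ 1) = (ZMod.stdAddChar (k μ) : ℂ) := by
    rw [torusChar, Finset.prod_eq_single μ]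
    · simp
    · intro i _ hi
      simp [Pi.single_eq_of_ne hi]
    · simp
  rw [this, ZMod.stdAddChar_apply, ZMod.toCircle_apply]
  congr 1
  push_cast
  ring

/-! ### The Fourier kernel at separation one -/

/-- The free twisted propagator kernel between neighbouring sites (forward):
`K(y + e_μ, y) = L⁻⁴ Σ_k χ_k(e_μ) M(k)ᴴ / h(k)`, and its trace against a spin matrix. -/
theorem trace_kernel_shift_left (M : TorusSite 4 L → Matrix (Fin 4) (Fin 4) ℂ) (h : TorusSite 4 L → ℝ)
    (G : Matrix (Fin 4) (Fin 4) ℂ) (y : TorusSite 4 L) (μ : Fin 4) :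
    ((Matrix.of fun α β => ((L : ℂ) ^ 4)⁻¹ * ∑ k, torusChar k (QuantumFieldTheory.Site.shift y μ) *
        conj (torusChar k y) * (M k)ᴴ α β / ((h k : ℝ) : ℂ)) * G).trace =
      ((L : ℂ) ^ 4)⁻¹ * ∑ k, torusChar k (Pi.single μ 1) * ((M k)ᴴ * G).trace / ((h k : ℝ) : ℂ) := by
  have hchar : ∀ k : TorusSite 4 L, torusChar k (QuantumFieldTheory.Site.shift y μ) * conj (torusChar k y) =
      torusChar k (Pi.single μ 1) := fun k => by
    rw [QuantumFieldTheory.Site.shift, torusChar_add_right, mul_comm (torusChar k y), mul_assoc,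
      torusChar_mul_conj, mul_one]
  have hK : (Matrix.of fun α β => ((L : ℂ) ^ 4)⁻¹ * ∑ k, torusChar k (QuantumFieldTheory.Site.shift y μ) *
        conj (torusChar k y) * (M k)ᴴ α β / ((h k : ℝ) : ℂ)) =
      ((L : ℂ) ^ 4)⁻¹ • ∑ k, (torusChar k (Pi.single μ 1) / ((h k : ℝ) : ℂ)) • (M k)ᴴ := by
    ext α β
    simp only [of_apply, Matrix.smul_apply, Matrix.sum_apply, smul_eq_mul, Finset.mul_sum]
    refine Finset.sum_congr rfl fun k _ => ?_
    rw [hchar k]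
    ring
  rw [hK, Matrix.smul_mul, Matrix.sum_mul, trace_smul, trace_sum, smul_eq_mul, Finset.mul_sum, Finset.mul_sum]
  refine Finset.sum_congr rfl fun k _ => ?_
  rw [Matrix.smul_mul, trace_smul, smul_eq_mul]
  ring

/-- The free twisted propagator kernel between neighbouring sites (backward):
`K(x, x + e_μ) = L⁻⁴ Σ_k conj χ_k(e_μ) M(k)ᴴ / h(k)`, and its trace against a spin matrix. -/
theorem trace_kernel_shift_right (M : TorusSite 4 L → Matrix (Fin 4) (Fin 4) ℂ) (h : TorusSite 4 L → ℝ)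
    (G : Matrix (Fin 4) (Fin 4) ℂ) (x : TorusSite 4 L) (μ : Fin 4) :
    ((Matrix.of fun α β => ((L : ℂ) ^ 4)⁻¹ * ∑ k, torusChar k x *
        conj (torusChar k (QuantumFieldTheory.Site.shift x μ)) * (M k)ᴴ α β / ((h k : ℝ) : ℂ)) * G).trace =
      ((L : ℂ) ^ 4)⁻¹ * ∑ k, conj (torusChar k (Pi.single μ 1)) * ((M k)ᴴ * G).trace / ((h k : ℝ) : ℂ) := by
  have hchar : ∀ k : TorusSite 4 L, torusChar k x * conj (torusChar k (QuantumFieldTheory.Site.shift x μ)) =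
      conj (torusChar k (Pi.single μ 1)) := fun k => by
    rw [QuantumFieldTheory.Site.shift, torusChar_add_right, map_mul, ← mul_assoc, torusChar_mul_conj, one_mul]
  have hK : (Matrix.of fun α β => ((L : ℂ) ^ 4)⁻¹ * ∑ k, torusChar k x *
        conj (torusChar k (QuantumFieldTheory.Site.shift x μ)) * (M k)ᴴ α β / ((h k : ℝ) : ℂ)) =
      ((L : ℂ) ^ 4)⁻¹ • ∑ k, (conj (torusChar k (Pi.single μ 1)) / ((h k : ℝ) : ℂ)) • (M k)ᴴ := by
    ext α β
    simp only [of_apply, Matrix.smul_apply, Matrix.sum_apply, smul_eq_mul, Finset.mul_sum]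
    refine Finset.sum_congr rfl fun k _ => ?_
    rw [hchar k]
    ring
  rw [hK, Matrix.smul_mul, Matrix.sum_mul, trace_smul, trace_sum, smul_eq_mul, Finset.mul_sum, Finset.mul_sum]
  refine Finset.sum_congr rfl fun k _ => ?_
  rw [Matrix.smul_mul, trace_smul, smul_eq_mul]
  ring

/-! ### The reflection `k ↦ -k - 1` of the antiperiodic momentum grid -/

omit [NeZero L] in
/-- The value of `-k - 1` in `ZMod L`: `L - 1 - k.val`. -/
theorem val_neg_sub_one [NeZero L] (a : ZMod L) : (-a - 1 : ZMod L).val = L - 1 - a.val := by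
  have ha : a.val < L := ZMod.val_lt a
  have hcast : (-a - 1 : ZMod L) = ((L - 1 - a.val : ℕ) : ZMod L) := by
    have h1 : ((L - 1 - a.val : ℕ) : ZMod L) + (a.val : ℕ) + 1 = 0 := by
      have : ((L - 1 - a.val : ℕ) : ZMod L) + (a.val : ℕ) + 1 = ((L - 1 - a.val + a.val + 1 : ℕ) : ZMod L) := by
        push_cast; ring
      rw [this, show L - 1 - a.val + a.val + 1 = L by omega, ZMod.natCast_self]
    rw [ZMod.natCast_zmod_val] at h1
    have : ((L - 1 - a.val : ℕ) : ZMod L) = -a - 1 := by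
      calc ((L - 1 - a.val : ℕ) : ZMod L) = (((L - 1 - a.val : ℕ) : ZMod L) + a + 1) - a - 1 := by ring
        _ = -a - 1 := by rw [h1]; ring
    exact this.symm
  rw [hcast, ZMod.val_natCast_of_lt (by omega)]

/-- The antiperiodic angle is reflected: `φ(-k-1) = 2π − φ(k)` where `φ(k) = (2 k.val + 1)π/L`. -/
theorem apAngle_reflect (a : ZMod L) :
    2 * Real.pi * (((-a - 1 : ZMod L)).val : ℝ) / L + Real.pi / L =
      2 * Real.pi - (2 * Real.pi * ((a.val : ℕ) : ℝ) / L + Real.pi / L) := by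
  have hL : (L : ℝ) ≠ 0 := Nat.cast_ne_zero.mpr (NeZero.ne L)
  have ha : a.val < L := ZMod.val_lt a
  rw [val_neg_sub_one]
  have : ((L - 1 - a.val : ℕ) : ℝ) = (L : ℝ) - 1 - (a.val : ℝ) := by
    rw [Nat.cast_sub (by omega), Nat.cast_sub (by omega)]
    simp
  rw [this]
  field_simp
  ring

omit [NeZero L] in
/-- The reflection `k ↦ -k - 1` of the momentum grid is an involution. -/
theorem reflect_involutive : Function.Involutive (fun k : TorusSite 4 L => fun ν => -k ν - 1) := by
  intro k; funext ν; ring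

/-- **Reality of the linear coefficient**: the sum `Z_μ = Σ_k e^{iφ_μ(k)} (w(k) + i sin φ_μ(k)) / h(k)` over
the antiperiodic grid is invariant under complex conjugation (reflection `k ↦ -k - 1`). -/
theorem conj_sum_apCoefficient (m : ℝ) (φ : TorusSite 4 L → Fin 4 → ℝ)
    (hφ : ∀ k ν, φ k ν = 2 * Real.pi * ((k ν).val : ℝ) / L + Real.pi / L)
    (w h : TorusSite 4 L → ℝ) (hw : ∀ k, w k = m + ∑ ν, (1 - Real.cos (φ k ν)))
    (hh : ∀ k, h k = w k ^ 2 + ∑ ν, Real.sin (φ k ν) ^ 2) (μ : Fin 4) :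
    conj (∑ k, Complex.exp (φ k μ * I) * ((w k : ℂ) + I * Real.sin (φ k μ)) / (h k : ℂ)) =
      ∑ k, Complex.exp (φ k μ * I) * ((w k : ℂ) + I * Real.sin (φ k μ)) / (h k : ℂ) := by
  set σ : Equiv.Perm (TorusSite 4 L) := reflect_involutive.toPerm _ with hσ
  have hσapp : ∀ k ν, (σ k) ν = -k ν - 1 := fun k ν => rfl
  have hφσ : ∀ k ν, φ (σ k) ν = 2 * Real.pi - φ k ν := fun k ν => by
    rw [hφ, hφ, hσapp, apAngle_reflect]
  have hcos : ∀ k ν, Real.cos (φ (σ k) ν) = Real.cos (φ k ν) := fun k ν => by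
    rw [hφσ, Real.cos_two_pi_sub]
  have hsin : ∀ k ν, Real.sin (φ (σ k) ν) = -Real.sin (φ k ν) := fun k ν => by
    rw [hφσ, Real.sin_two_pi_sub]
  have hwσ : ∀ k, w (σ k) = w k := fun k => by simp only [hw, hcos]
  have hhσ : ∀ k, h (σ k) = h k := fun k => by simp only [hh, hwσ, hsin, neg_sq]
  have hexpσ : ∀ k, Complex.exp (φ (σ k) μ * I) = conj (Complex.exp (φ k μ * I)) := fun k => by
    rw [hφσ, ← Complex.exp_conj, map_mul, Complex.conj_ofReal, Complex.conj_I]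
    push_cast
    rw [sub_mul, Complex.exp_sub, show (2 * (Real.pi : ℂ)) * I = 2 * Real.pi * I by ring,
      Complex.exp_two_pi_mul_I, one_div, ← Complex.exp_neg, mul_neg]
  rw [map_sum, ← Equiv.sum_comp σ]
  refine Finset.sum_congr rfl fun k _ => ?_
  rw [map_div₀, map_mul, map_add, map_mul, Complex.conj_ofReal, Complex.conj_ofReal, Complex.conj_ofReal,
    Complex.conj_I, hexpσ, Complex.conj_conj, hwσ, hhσ, hsin]
  push_cast
  ring

/-- **Size of the linear coefficient**: `‖Z_μ‖ ≤ (|m| + 9) Σ_k 1/h(k)`. -/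
theorem norm_sum_apCoefficient_le (m : ℝ) (φ : TorusSite 4 L → Fin 4 → ℝ)
    (w h : TorusSite 4 L → ℝ) (hw : ∀ k, w k = m + ∑ ν, (1 - Real.cos (φ k ν)))
    (hpos : ∀ k, 0 < h k) (μ : Fin 4) :
    ‖∑ k, Complex.exp (φ k μ * I) * ((w k : ℂ) + I * Real.sin (φ k μ)) / (h k : ℂ)‖ ≤
      (|m| + 9) * ∑ k, (h k)⁻¹ := by
  have hwk : ∀ k, |w k| ≤ |m| + 8 := fun k => by
    rw [hw]
    refine (abs_add_le _ _).trans (add_le_add le_rfl ?_)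
    refine (Finset.abs_sum_le_sum_abs _ _).trans ?_
    calc ∑ ν : Fin 4, |1 - Real.cos (φ k ν)| ≤ ∑ _ν : Fin 4, (2 : ℝ) :=
          Finset.sum_le_sum fun ν _ => by
            rw [abs_le]; constructor <;> nlinarith [Real.cos_le_one (φ k ν), Real.neg_one_le_cos (φ k ν)]
      _ = 8 := by simp; norm_num
  refine (norm_sum_le _ _).trans ?_
  rw [Finset.mul_sum]
  refine Finset.sum_le_sum fun k _ => ?_
  rw [norm_div, norm_mul, Complex.norm_exp_ofReal_mul_I, one_mul, Complex.norm_real, Real.norm_eq_abs,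
    abs_of_pos (hpos k), div_eq_mul_inv]
  refine mul_le_mul_of_nonneg_right ?_ (inv_nonneg.mpr (hpos k).le)
  calc ‖(w k : ℂ) + I * Real.sin (φ k μ)‖ ≤ ‖(w k : ℂ)‖ + ‖I * (Real.sin (φ k μ) : ℂ)‖ := norm_add_le _ _
    _ ≤ (|m| + 8) + 1 := by
        rw [Complex.norm_real, Real.norm_eq_abs, norm_mul, Complex.norm_I, one_mul, Complex.norm_real,
          Real.norm_eq_abs]
        exact add_le_add (hwk k) (Real.abs_sin_le_one _)
    _ = |m| + 9 := by ring

end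

end Summit.QuantumFields.QCD.Cruxes.WilsonQuarkStability.FreeTangentLandauChessboard
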